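import Summits.QuantumFields.BalabanUV.Beta.FP.TorusCompositeCovarianceTwoSym
import Summits.QuantumFields.BalabanUV.Beta.FP.TorusCompositeCovarianceOneRowsSym
import Summits.QuantumFields.BalabanUV.Beta.FP.TorusCompositeCovarianceTwoRows

/-!
# `BalabanUV.Beta.FP.TorusCompositeCovarianceTwoRowsSym` — road «FP» for binder row D1, ROUTE T, (β1) RE-BASING (ROW RULING R-D1-g52-1 (3)(c)), **(COV-m) ORDER 2
# FOR THE (0.4)-SYMMETRISED TOWER, PART 3 (`d + 1 = 4`) — THE `-Sym` DOOR's ROWS `c2` AND `d2` BY TERM at the constant centred root list**: with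
# `Q₁₂ := c² • compIns₂Sym …` (R-23's ♭ second jet), `Q₁₁ := c • compIns₁Sym …` (R-21), `W₀ = towerGen`, `W₁ W₂` the door's VERBATIM, **`Q₁₂·W₀ + 2•(Q₁₁·W₁) + Q₁₀·W₂ =
# fromCols D̄₂ 0`**, `D̄₂(a, t̄) = (c²·σ_{n+1}⁻¹)·((compRowsSym … (n+1)·h) a)²·[t̄ = a.1 + e_{a.2}]` (the PURE SQUARE), and **`Q₂₂·(σ_{n+1}•D̄) + 2•(Q₂₁·D̄₁) + Q₂₀·D̄₂ = 0`**
# with `Q₂₂ := c_{lev 0} •` the top step's plain sym bi-member along the direction transported one level up — the sym twins of leaf-02 g26's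
# `TorusCompositeCovarianceTwoRows.torus_c2_tower ∕ torus_d2_tower`

WHY.  The rooted PART 3 reads I-4's all-columns law through the tower generators and the top step's ♭ bi-member against the top comb's residual columns.  For the
(β1) tower: R-26 supplies the composite law (`compIns₂Sym_mul_tgrad`, `d + 1 = 4`), the rooted C2-Rows §1 (`towerGen_eq_tgrad_mul_evalN ∕ evalN_itRoot_rootPt ∕
W₁_eq_neg_smul_tip_mul_evalN`) and TwoRows' `W₂_eq_smul_tip_mul_evalN ∕ bimember_res_algebra` are root-list-generic and read BY NAME at the constant list, and the top
step's residual-column law comes from my g23 `submatrix_borderT2per_mul_tgrad` through R-25's sign bridge (`perF_dper_symPair_eq_neg`, any torus) with the far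
root off the residual columns.

WHAT (`d := 3`; blocking `Lc`, `[NeZero Lc]`; `hc : ctrOff (3+1) Lc ∈ box (3+1) Lc`; constant root list `fun _ => ctrOff (3+1) Lc`).
* §1 **`torus_c2_towerSym (hc) (n c h) (hW₁ hW₂)`** — TwoRows' `torus_c2_tower` VERBATIM under the (β1) substitution.
* §2 `pair_mul_tgrad_res_apply_sym`, **`bimember_mul_tgrad_res_sym (hc) (hM′) (ℓ) (pμ′ mμ′) (v)`** (the top step's weighted plain sym bi-member against the CENTRED
  comb's residual gauge columns: `2 • ((Σ_b v b • M^{b}_sym) · Tip(v)) − c_ℓ • (Q₂₀^sym · Tip(v⊙v))`), **`torus_d2_towerSym (hc) (hM′) (n c h) (pμ′ mμ′)`** — `= 0` as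
  displayed in the `-Sym` doors, `Q₂₀ := (perF M′ (bhKStepSh 3 Lc (Dsh Lc) (lev 0)))↾((pμ′, inr mμ′) × fields)`, `Dbar := σ_{n+1} • D̄` (R-20's `c0`).
NOT HERE: generic `d`; any chart; any estimate.  [folklore] finite sums BY NAME over OUR bookkeeping objects and an1's typed tables; no `def`, no `def … : Prop`, nothing
cited, 0 sorry, default heartbeats.  Nothing of the dictionary ∕ Bałaban's non-linear averages asserted ((β1) is the ROW's ruling, quoted); NO chart fixed; the (C1)
TABLES, the seven letters, `hH ∕ hQ` untouched.

HONEST DEPENDENCY (page 1, mandatory): continuum YM on T⁴ ⇐ BetaPertH ∧ nine spine estimates (0/9 proved); BetaPertH ⇐ (D1) ∧ (D4) ∧ CAP+tail;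
G-an2-4 gates asym, D1 and NE2/3/4.  HONEST FRAMING (cell contract, verbatim): «discharging `BetaPertH` makes Bałaban's UV stability UNCONDITIONAL —
a real constructive-QFT result; it is NOT the continuum limit and NOT the Clay problem.»  ABSOLUTE RULE (cell charter, verbatim): «No internally-minted
statement may enter as a cited fact. Every hypothesis is either kernel-proved in this package or a verbatim quotation of a PUBLISHED theorem with page
reference. The manuscript(s) under audit are NOT citable for their own disputed steps — they are the thing under adjudication; programme-internal
(2001/route/tribunal) claims are never citable.»  0 estimates; 0∕4 row-D1 binders (hW, hR, D1Tel, D1Rep); NOT (T-ID), NOT (C1), NOT SDF, NOT D1,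
NOT BetaPertH, NOT continuum, NOT Clay.  D1 formalisation swarm LEAF PROVER 02 (b2b-balaban-beta-d1-formalise-leaf-02 gen 32), 2026-08-24.  No existing file touched.
-/

noncomputable section

open scoped BigOperators

namespace Summit.QuantumFields.BalabanUV.Beta.FP.TorusCompositeCovarianceTwoRowsSym

open Matrix Finset
open Literature.Probability.LatticeModels (Torus.proj)
open Literature.MathematicalPhysics.QuantumFieldTheory
open Literature.MathematicalPhysics.QuantumFieldTheory.Balaban1983to89
open Literature.MathematicalPhysics.QuantumFieldTheory.Balaban1983to89.Beta
open ExpKernelCalculus (MKer)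
open B5Prop11Plancherel (fine)
open B6Lemma24Torus (pbox mem_pbox)
open AffineAveraging (Site box toSite unitVec)
open AveragingContoursRooted (ctr ctrOff ctrOff_mem_box)
open LatticeForm (quo)
open OneStepResolventKernel (Fib)
open B4TorusKernel.MultiPeriod (translate)
open Summit.QuantumFields.BalabanUV.Beta.BorderedHessian (stepScale stepScale_ne_zero)
open Summit.QuantumFields.BalabanUV.Beta.DshAn1 (Dsh)
open Summit.QuantumFields.BalabanUV.Beta.SymShiftedSpread (bhKStepSh)
open Summit.QuantumFields.BalabanUV.Beta.SymAveragingHessianCounts (symVhSAt)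
open Summit.QuantumFields.BalabanUV.Beta.SymAveragingMixedJetTables (symVh₂SAt)
open Summit.QuantumFields.BalabanUV.Beta.SymSecondOrderTablesAn1 (symVh₂SAn1)
open Summit.QuantumFields.BalabanUV.Beta.FP.KernelPeriodisationFib (Idx perF perF_apply)
open Summit.QuantumFields.BalabanUV.Beta.FP.KernelPeriodisationFibLoc (dper)
open Summit.QuantumFields.BalabanUV.Beta.FP.TorusGaugeCovariance (tdelta tgrad)
open Summit.QuantumFields.BalabanUV.Beta.FP.TorusGaugeCovariancePairing (wrapPt wrapPt_of_mem)
open Summit.QuantumFields.BalabanUV.Beta.FP.TorusGaugeCovarianceCoarse (coarsePt)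
open Summit.QuantumFields.BalabanUV.Beta.FP.TorusCombRows (Res ne_rootOf_iff_proj_ne)
open Summit.QuantumFields.BalabanUV.Beta.GAN24.FineReadoutCauchyFrame (toSite_mem_range)
open Summit.QuantumFields.BalabanUV.Beta.FP.PeriodisedBorderWardContact (tdelta_far_eq_zero_of_not_root)
open Summit.QuantumFields.BalabanUV.Beta.FP.PeriodisedSymBorderWardContact (perZ_bhKStepSh_inr_inl_of_proj_ne)
open Summit.QuantumFields.BalabanUV.Beta.FP.PeriodisedSymBorderWardContactTwo (submatrix_borderT2per_mul_tgrad)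
open Summit.QuantumFields.BalabanUV.Beta.FP.TorusCompositeObjects
open Summit.QuantumFields.BalabanUV.Beta.FP.TorusCompositeObjectsG (QstepSym compRowsSym)
open Summit.QuantumFields.BalabanUV.Beta.FP.TorusCompositeFP (evalN evalN_succ)
open Summit.QuantumFields.BalabanUV.Beta.FP.TorusCompositeCovariance (rootPt itRoot itRoot_succ quo_itRoot)
open Summit.QuantumFields.BalabanUV.Beta.FP.TorusCompositeCovarianceOne (tdelta_wrapPt of_tdelta_mul prod_stepScale_mul_card_ne_zero')
open Summit.QuantumFields.BalabanUV.Beta.FP.TorusCompositeCovarianceOneRows (towerGen_eq_tgrad_mul_evalN evalN_congr evalN_itRoot_rootPt W₁_eq_neg_smul_tip_mul_evalN)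
open Summit.QuantumFields.BalabanUV.Beta.FP.TorusCompositeCovarianceTwoStep (ite_bond_eq)
open Summit.QuantumFields.BalabanUV.Beta.FP.TorusCompositeCovarianceTwoRows (W₂_eq_smul_tip_mul_evalN bimember_res_algebra)
open Summit.QuantumFields.BalabanUV.Beta.FP.TorusStepInsertionSym (stepIns₁Sym)
open Summit.QuantumFields.BalabanUV.Beta.FP.TorusCompositeCovarianceOneSym (compIns₁Sym)
open Summit.QuantumFields.BalabanUV.Beta.FP.TorusCompositeCovarianceTwoPolarSym (compIns₂Sym)
open Summit.QuantumFields.BalabanUV.Beta.FP.TorusCompositeCovarianceTwoStepSym (perF_dper_symPair_eq_neg)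
open Summit.QuantumFields.BalabanUV.Beta.FP.TorusCompositeCovarianceTwoSym (compIns₂Sym_mul_tgrad)

variable (Lc : ℕ) [NeZero Lc]

/-! ## §1 The door's composite covariance row `c2` -/

section RowC2

variable (M' : Fin (3 + 1) → ℕ) [∀ μ, NeZero (M' μ)] (lev : ℕ → ℕ) (rs : ℕ → (Fin (3 + 1) → ℕ))

/-- [folklore] **`torus_c2_tower` — (COV-m) ORDER 2: THE DOOR's COMPOSITE COVARIANCE ROW `c2` AT EVERY DEPTH.**  With `Q₁₂ := c² • compIns₂ Lc M′ lev rs (n+1) h` (PART 2's ♭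
chain-rule second jet of the composite averaging along `h`), `Q₁₁ := c • compIns₁ …` (C2), `W₀ := towerGen …`, `W₁ W₂` the door's `hW₁ hW₂` VERBATIM (weight `c`):
`Q₁₂·W₀ + 2•(Q₁₁·W₁) + Q₁₀·W₂ = fromCols D̄₂ 0`, `D̄₂(a, t̄) = (c²·σ_{n+1}⁻¹)·((compRows … (n+1)·h) a)²·[t̄ = a.1 + e_{a.2}]` — the composite second jet's coarse image is the
PURE-SQUARE tip-type jet of the transported direction on EVERY top bond, and every lower generator is killed.  Proof: PART 2's all-columns law through `towerGen = D·evalN`;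
tip terms `= −2•Q₁₁·W₁ − Q₁₀·W₂`; far-root term: top block by `quo_itRoot`, lower blocks by `evalN_itRoot_rootPt`. -/
theorem torus_c2_towerSym (hc : ctrOff (3 + 1) Lc ∈ box (3 + 1) Lc) (n : ℕ) (c : ℝ) (h : ↥(pbox (towerTorus Lc M' (n + 1))) × Fin (3 + 1) → ℝ)
    {W₁ W₂ : Matrix (↥(pbox (towerTorus Lc M' (n + 1))) × Fin (3 + 1)) (NParam Lc M' (fun _ : ℕ => ctrOff (3 + 1) Lc) (n + 1)) ℝ}
    (hW₁ : W₁ = Matrix.of fun (b : (↥(pbox (towerTorus Lc M' (n + 1))) × Fin (3 + 1))) (e : NParam Lc M' (fun _ : ℕ => ctrOff (3 + 1) Lc) (n + 1)) =>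
      -(c * h b * evalN Lc M' (fun _ : ℕ => ctrOff (3 + 1) Lc) (n + 1) (fun b' : (↥(pbox (towerTorus Lc M' (n + 1))) × Fin (3 + 1)) => (b'.1 : Site (3 + 1)) + unitVec b'.2) b e))
    (hW₂ : W₂ = Matrix.of fun (b : (↥(pbox (towerTorus Lc M' (n + 1))) × Fin (3 + 1))) (e : NParam Lc M' (fun _ : ℕ => ctrOff (3 + 1) Lc) (n + 1)) =>
      (c * h b) ^ 2 * evalN Lc M' (fun _ : ℕ => ctrOff (3 + 1) Lc) (n + 1) (fun b' : (↥(pbox (towerTorus Lc M' (n + 1))) × Fin (3 + 1)) => (b'.1 : Site (3 + 1)) + unitVec b'.2) b e) :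
    c ^ 2 • compIns₂Sym Lc M' lev (fun _ : ℕ => ctrOff (3 + 1) Lc) (n + 1) h * towerGen Lc M' (fun _ : ℕ => ctrOff (3 + 1) Lc) (n + 1) + (2 : ℝ) • (c • compIns₁Sym Lc M' lev (fun _ : ℕ => ctrOff (3 + 1) Lc) (n + 1) h * W₁) + compRowsSym Lc M' lev (fun _ : ℕ => ctrOff (3 + 1) Lc) (n + 1) * W₂
      = Matrix.fromCols
          (Matrix.of fun (a : ↥(pbox M') × Fin (3 + 1)) (t : Res (toSite (ctrOff (3 + 1) Lc)) Lc M') =>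
            (c ^ 2 * (∏ i ∈ range (n + 1), (stepScale 3 Lc (lev (i + 1)) * ((box (3 + 1) Lc).card : ℝ)))⁻¹)
              * ((compRowsSym Lc M' lev (fun _ : ℕ => ctrOff (3 + 1) Lc) (n + 1) *ᵥ h) a) ^ 2 * tdelta M' ((a.1 : Site (3 + 1)) + unitVec a.2) t.1)
          (0 : Matrix (↥(pbox M') × Fin (3 + 1)) (NParam Lc (fine Lc M') (fun _ : ℕ => ctrOff (3 + 1) Lc) n) ℝ) := by
  -- the far-root contact through the point-evaluation matrix, weighted by `c²·σ⁻¹`: top block = the coarse jet, lower blocks vanish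
  have hfar : (c ^ 2 * (∏ i ∈ range (n + 1), (stepScale 3 Lc (lev (i + 1)) * ((box (3 + 1) Lc).card : ℝ)))⁻¹) •
        (Matrix.of (fun (a : ↥(pbox M') × Fin (3 + 1)) (s : ↥(pbox (towerTorus Lc M' (n + 1)))) =>
          ((compRowsSym Lc M' lev (fun _ : ℕ => ctrOff (3 + 1) Lc) (n + 1) *ᵥ h) a) ^ 2
            * tdelta (towerTorus Lc M' (n + 1)) ((itRoot Lc M' (fun _ : ℕ => ctrOff (3 + 1) Lc) (fun _ => hc) (n + 1) (wrapPt M' ((a.1 : Site (3 + 1)) + unitVec a.2)) : ↥(pbox (towerTorus Lc M' (n + 1)))) : Site (3 + 1)) s)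
          * evalN Lc M' (fun _ : ℕ => ctrOff (3 + 1) Lc) (n + 1) (fun s : ↥(pbox (towerTorus Lc M' (n + 1))) => (s : Site (3 + 1))))
      = Matrix.fromCols
          (Matrix.of fun (a : ↥(pbox M') × Fin (3 + 1)) (t : Res (toSite (ctrOff (3 + 1) Lc)) Lc M') =>
            (c ^ 2 * (∏ i ∈ range (n + 1), (stepScale 3 Lc (lev (i + 1)) * ((box (3 + 1) Lc).card : ℝ)))⁻¹)
              * ((compRowsSym Lc M' lev (fun _ : ℕ => ctrOff (3 + 1) Lc) (n + 1) *ᵥ h) a) ^ 2 * tdelta M' ((a.1 : Site (3 + 1)) + unitVec a.2) t.1)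
          (0 : Matrix (↥(pbox M') × Fin (3 + 1)) (NParam Lc (fine Lc M') (fun _ : ℕ => ctrOff (3 + 1) Lc) n) ℝ) := by
    rw [of_tdelta_mul, evalN_succ]
    ext a e
    rcases e with t | e
    · simp only [Matrix.smul_apply, Matrix.of_apply, Matrix.fromCols_apply_inl, wrapPt_of_mem, smul_eq_mul]
      rw [bigRatio_eq_pow, quo_itRoot, tdelta_wrapPt]
      ring
    · simp only [Matrix.smul_apply, Matrix.of_apply, Matrix.fromCols_apply_inr, Matrix.zero_apply, wrapPt_of_mem, smul_eq_mul, itRoot_succ]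
      dsimp only [towerTorus_succ]
      rw [evalN_itRoot_rootPt Lc n M' (fun _ : ℕ => ctrOff (3 + 1) Lc) (fun _ => hc), mul_zero, mul_zero]
  rw [hW₁, W₁_eq_neg_smul_tip_mul_evalN, hW₂, W₂_eq_smul_tip_mul_evalN, towerGen_eq_tgrad_mul_evalN Lc (n + 1) M' (fun _ : ℕ => ctrOff (3 + 1) Lc), Matrix.smul_mul, ← Matrix.mul_assoc,
    compIns₂Sym_mul_tgrad Lc hc (n + 1) M' lev (fun _ : ℕ => ctrOff (3 + 1) Lc) h, ← hfar]
  simp only [Matrix.add_mul, Matrix.sub_mul, Matrix.smul_mul, Matrix.mul_smul, Matrix.mul_neg, smul_neg, smul_add, smul_sub, Matrix.mul_assoc, smul_smul]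
  module

end RowC2

/-! ## §2 The top step's coarse covariance row `d2` along the transported direction -/

section RowD2

variable {Lc} {M' : Fin (3 + 1) → ℕ} [∀ μ, NeZero (M' μ)]

open Classical in
/-- [folklore] **THE PER-PAIR ENTRY OF THE TOP STEP's SYM BI-MEMBER AGAINST THE CENTRED COMB's RESIDUAL GAUGE COLUMNS** in ANY multiplier presentation
`k ↦ (pμ′ k, inr (mμ′ k))` (`Lc ∣ M′`, any level `ℓ`): my g23 per-pair law (`submatrix_borderT2per_mul_tgrad`, `d + 1 = 4`) through R-25's sign bridge, with the far-root
term OFF the residual columns (`tdelta_far_eq_zero_of_not_root` when the multiplier site is coarse, my g18 `perZ_bhKStepSh_inr_inl_of_proj_ne` when it is not). -/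
theorem pair_mul_tgrad_res_apply_sym (hc : ctrOff (3 + 1) Lc ∈ box (3 + 1) Lc) (hM' : ∀ i, Lc ∣ M' i) (ℓ : ℕ)
    {κ : Type*} (pμ' : κ → ↥(pbox M')) (mμ' : κ → Fin (3 + 1)) (b b' : ↥(pbox M') × Fin (3 + 1)) (k : κ) (t : Res (toSite (ctrOff (3 + 1) Lc)) Lc M') :
    ((perF M' (dper M' (fun x z a c => ∑' n : Site (3 + 1), (1 / 2 : ℝ) *
        (symVh₂SAt (ctr (3 + 1) Lc) Lc b.2 (b.1 : Site (3 + 1)) b'.2 (translate M' (b'.1 : Site (3 + 1)) n) x z a c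
          + symVh₂SAt (ctr (3 + 1) Lc) Lc b'.2 (translate M' (b'.1 : Site (3 + 1)) n) b.2 (b.1 : Site (3 + 1)) x z a c)))).submatrix
          (fun k : κ => ((pμ' k, Sum.inr (mμ' k)) : Idx M' (Fib 3))) (fun c : ↥(pbox M') × Fin (3 + 1) => ((c.1, Sum.inl c.2) : Idx M' (Fib 3)))
        * (tgrad M').submatrix (fun a : ↥(pbox M') × Fin (3 + 1) => ((a.1, Sum.inl a.2) : Idx M' (Fib 3))) (fun t : Res (toSite (ctrOff (3 + 1) Lc)) Lc M' => (t.1 : ↥(pbox M')))) k t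
      = tdelta M' ((b'.1 : Site (3 + 1)) + unitVec b'.2) t.1
            * perF M' (dper M' (symVhSAt (ctr (3 + 1) Lc) 3 Lc rfl b.2 (b.1 : Site (3 + 1)))) (pμ' k, Sum.inr (mμ' k)) (b'.1, Sum.inl b'.2)
        + tdelta M' ((b.1 : Site (3 + 1)) + unitVec b.2) t.1
            * perF M' (dper M' (symVhSAt (ctr (3 + 1) Lc) 3 Lc rfl b'.2 (b'.1 : Site (3 + 1)))) (pμ' k, Sum.inr (mμ' k)) (b.1, Sum.inl b.2)
        - tdelta M' ((b.1 : Site (3 + 1)) + unitVec b.2) t.1 * ((if b = b' then (1 : ℝ) else 0)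
            * ((((Lc : ℝ) ^ (3 + 1) * stepScale 3 Lc ℓ)⁻¹) * perF M' (bhKStepSh 3 Lc (Dsh Lc) ℓ) (pμ' k, Sum.inr (mμ' k)) (b.1, Sum.inl b.2))) := by
  have hL0 : 0 < Lc := Nat.pos_of_ne_zero (NeZero.ne Lc)
  have ht : Torus.proj Lc (((t.1 : ↥(pbox M')) : Site (3 + 1)) - toSite (ctrOff (3 + 1) Lc)) ≠ 0 := (ne_rootOf_iff_proj_ne hL0 (toSite_mem_range hc) _).1 t.2
  -- the sign bridge, entry by entry
  have hneg : ((perF M' (dper M' (fun x z a c => ∑' n : Site (3 + 1), (1 / 2 : ℝ) *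
        (symVh₂SAt (ctr (3 + 1) Lc) Lc b.2 (b.1 : Site (3 + 1)) b'.2 (translate M' (b'.1 : Site (3 + 1)) n) x z a c
          + symVh₂SAt (ctr (3 + 1) Lc) Lc b'.2 (translate M' (b'.1 : Site (3 + 1)) n) b.2 (b.1 : Site (3 + 1)) x z a c)))).submatrix
          (fun k : κ => ((pμ' k, Sum.inr (mμ' k)) : Idx M' (Fib 3))) (fun c : ↥(pbox M') × Fin (3 + 1) => ((c.1, Sum.inl c.2) : Idx M' (Fib 3)))
        * (tgrad M').submatrix (fun a : ↥(pbox M') × Fin (3 + 1) => ((a.1, Sum.inl a.2) : Idx M' (Fib 3))) (fun t : Res (toSite (ctrOff (3 + 1) Lc)) Lc M' => (t.1 : ↥(pbox M')))) k t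
      = -(((perF M' (dper M' ((fun κ u x z a c => ∑' n : Site (3 + 1), symVh₂SAn1 3 Lc κ u b'.2 (translate M' (b'.1 : Site (3 + 1)) n) x z a c)
          b.2 (b.1 : Site (3 + 1))))).submatrix
          (fun k : κ => (((⟨((pμ' k : ↥(pbox M')) : Site (3 + 1)), (pμ' k).2⟩ : ↥(pbox M')), Sum.inr (mμ' k)) : Idx M' (Fib 3)))
          (fun c : ↥(pbox M') × Fin (3 + 1) => ((c.1, Sum.inl c.2) : Idx M' (Fib 3)))
        * (tgrad M').submatrix (fun a : ↥(pbox M') × Fin (3 + 1) => ((a.1, Sum.inl a.2) : Idx M' (Fib 3))) (fun t : Res (toSite (ctrOff (3 + 1) Lc)) Lc M' => (t.1 : ↥(pbox M')))) k t) := by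
    rw [Matrix.mul_apply, Matrix.mul_apply, ← Finset.sum_neg_distrib]
    refine Finset.sum_congr rfl fun q _ => ?_
    rw [← neg_mul]
    exact congrArg (fun s : ℝ => s * (tgrad M').submatrix (fun a : ↥(pbox M') × Fin (3 + 1) => ((a.1, Sum.inl a.2) : Idx M' (Fib 3)))
        (fun t : Res (toSite (ctrOff (3 + 1) Lc)) Lc M' => (t.1 : ↥(pbox M'))) q t)
      (perF_dper_symPair_eq_neg Lc M' b b' (pμ' k) q.1 (mμ' k) q.2)
  rw [hneg, submatrix_borderT2per_mul_tgrad (M := M') (M' := fun i => M' i / Lc) b'.2 (b'.1 : Site (3 + 1)) (fun i => (Nat.mul_div_cancel' (hM' i)).symm) rfl b'.1.2 ℓ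
      (fun k : κ => ((pμ' k : ↥(pbox M')) : Site (3 + 1))) (fun k => (pμ' k).2) mμ' (fun t : Res (toSite (ctrOff (3 + 1) Lc)) Lc M' => (t.1 : ↥(pbox M'))) b.2 b.1 k t,
    neg_neg, ite_bond_eq]
  by_cases hx : Torus.proj Lc ((pμ' k : ↥(pbox M')) : Site (3 + 1)) = 0
  · rw [tdelta_far_eq_zero_of_not_root hM' (ctr (3 + 1) Lc) hx (mμ' k) ht, zero_mul, add_zero]
  · simp only [perF_apply]
    rw [perZ_bhKStepSh_inr_inl_of_proj_ne (M := M') ℓ hx ((b.1 : ↥(pbox M')) : Site (3 + 1)) (mμ' k) b.2,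
      perZ_bhKStepSh_inr_inl_of_proj_ne (M := M') ℓ hx ((b'.1 : ↥(pbox M')) : Site (3 + 1)) (mμ' k) b'.2]
    ring

/-- [folklore] **`bimember_mul_tgrad_res` — THE TOP STEP's WEIGHTED ♭ BI-MEMBER AGAINST THE TOP COMB's RESIDUAL GAUGE COLUMNS**, in ANY multiplier presentation
`k ↦ (pμ′ k, inr (mμ′ k))` (`Lc ∣ M′`, root `r ∈ box`, any level `ℓ` on the right): `(Σ_b Σ_{b′} (v b·v b′) • T^{b,b′}) · D̄ = 2 • ((Σ_b v b • M^{b}) · Tip(v)) − c_ℓ • (Q₂₀ · Tip(v⊙v))`,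
`Tip(v)(b, t̄) = v b·[t̄ = b.1 + e_{b.2}]` — PART 1's `stepIns₂_mul_tgrad` one level up with the far root off the residual columns (C2 §3's `sum_smul_vhSAt_mul_tgrad_res`, one order up). -/
theorem bimember_mul_tgrad_res_sym (hc : ctrOff (3 + 1) Lc ∈ box (3 + 1) Lc) (hM' : ∀ i, Lc ∣ M' i) (ℓ : ℕ)
    {κ : Type*} (pμ' : κ → ↥(pbox M')) (mμ' : κ → Fin (3 + 1)) (v : ↥(pbox M') × Fin (3 + 1) → ℝ) :
    (∑ b : ↥(pbox M') × Fin (3 + 1), ∑ b' : ↥(pbox M') × Fin (3 + 1), (v b * v b') •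
        (perF M' (dper M' (fun x z a c => ∑' n : Site (3 + 1), (1 / 2 : ℝ) *
          (symVh₂SAt (ctr (3 + 1) Lc) Lc b.2 (b.1 : Site (3 + 1)) b'.2 (translate M' (b'.1 : Site (3 + 1)) n) x z a c
            + symVh₂SAt (ctr (3 + 1) Lc) Lc b'.2 (translate M' (b'.1 : Site (3 + 1)) n) b.2 (b.1 : Site (3 + 1)) x z a c)))).submatrix
          (fun k : κ => ((pμ' k, Sum.inr (mμ' k)) : Idx M' (Fib 3))) (fun c : ↥(pbox M') × Fin (3 + 1) => ((c.1, Sum.inl c.2) : Idx M' (Fib 3))))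
        * (tgrad M').submatrix (fun a : ↥(pbox M') × Fin (3 + 1) => ((a.1, Sum.inl a.2) : Idx M' (Fib 3))) (fun t : Res (toSite (ctrOff (3 + 1) Lc)) Lc M' => (t.1 : ↥(pbox M')))
      = (2 : ℝ) • ((∑ b : ↥(pbox M') × Fin (3 + 1), v b •
            (perF M' (dper M' (symVhSAt (ctr (3 + 1) Lc) 3 Lc rfl b.2 (b.1 : Site (3 + 1))))).submatrix (fun k : κ => ((pμ' k, Sum.inr (mμ' k)) : Idx M' (Fib 3)))
              (fun c : ↥(pbox M') × Fin (3 + 1) => ((c.1, Sum.inl c.2) : Idx M' (Fib 3))))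
          * Matrix.of (fun (b : ↥(pbox M') × Fin (3 + 1)) (t : Res (toSite (ctrOff (3 + 1) Lc)) Lc M') => v b * tdelta M' ((b.1 : Site (3 + 1)) + unitVec b.2) t.1))
        - (((Lc : ℝ) ^ (3 + 1) * stepScale 3 Lc ℓ)⁻¹) •
          ((perF M' (bhKStepSh 3 Lc (Dsh Lc) ℓ)).submatrix (fun k : κ => ((pμ' k, Sum.inr (mμ' k)) : Idx M' (Fib 3)))
              (fun b : ↥(pbox M') × Fin (3 + 1) => ((b.1, Sum.inl b.2) : Idx M' (Fib 3)))
            * Matrix.of (fun (b : ↥(pbox M') × Fin (3 + 1)) (t : Res (toSite (ctrOff (3 + 1) Lc)) Lc M') => (v b * v b) * tdelta M' ((b.1 : Site (3 + 1)) + unitVec b.2) t.1)) := by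
  ext k t
  have hL : ((∑ b : ↥(pbox M') × Fin (3 + 1), ∑ b' : ↥(pbox M') × Fin (3 + 1), (v b * v b') •
        (perF M' (dper M' (fun x z a c => ∑' n : Site (3 + 1), (1 / 2 : ℝ) *
          (symVh₂SAt (ctr (3 + 1) Lc) Lc b.2 (b.1 : Site (3 + 1)) b'.2 (translate M' (b'.1 : Site (3 + 1)) n) x z a c
            + symVh₂SAt (ctr (3 + 1) Lc) Lc b'.2 (translate M' (b'.1 : Site (3 + 1)) n) b.2 (b.1 : Site (3 + 1)) x z a c)))).submatrix
          (fun k : κ => ((pμ' k, Sum.inr (mμ' k)) : Idx M' (Fib 3))) (fun c : ↥(pbox M') × Fin (3 + 1) => ((c.1, Sum.inl c.2) : Idx M' (Fib 3))))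
        * (tgrad M').submatrix (fun a : ↥(pbox M') × Fin (3 + 1) => ((a.1, Sum.inl a.2) : Idx M' (Fib 3))) (fun t : Res (toSite (ctrOff (3 + 1) Lc)) Lc M' => (t.1 : ↥(pbox M')))) k t
      = ∑ b : ↥(pbox M') × Fin (3 + 1), ∑ b' : ↥(pbox M') × Fin (3 + 1), v b * v b'
          * (tdelta M' ((b'.1 : Site (3 + 1)) + unitVec b'.2) t.1
                * perF M' (dper M' (symVhSAt (ctr (3 + 1) Lc) 3 Lc rfl b.2 (b.1 : Site (3 + 1)))) (pμ' k, Sum.inr (mμ' k)) (b'.1, Sum.inl b'.2)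
            + tdelta M' ((b.1 : Site (3 + 1)) + unitVec b.2) t.1
                * perF M' (dper M' (symVhSAt (ctr (3 + 1) Lc) 3 Lc rfl b'.2 (b'.1 : Site (3 + 1)))) (pμ' k, Sum.inr (mμ' k)) (b.1, Sum.inl b.2)
            - tdelta M' ((b.1 : Site (3 + 1)) + unitVec b.2) t.1 * ((if b = b' then (1 : ℝ) else 0)
                * ((((Lc : ℝ) ^ (3 + 1) * stepScale 3 Lc ℓ)⁻¹) * perF M' (bhKStepSh 3 Lc (Dsh Lc) ℓ) (pμ' k, Sum.inr (mμ' k)) (b.1, Sum.inl b.2)))) := by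
    rw [Matrix.sum_mul, Matrix.sum_apply]
    refine Finset.sum_congr rfl fun b _ => ?_
    rw [Matrix.sum_mul, Matrix.sum_apply]
    refine Finset.sum_congr rfl fun b' _ => ?_
    rw [Matrix.smul_mul, Matrix.smul_apply, smul_eq_mul, pair_mul_tgrad_res_apply_sym hc hM' ℓ pμ' mμ' b b' k t]
  rw [hL, bimember_res_algebra]
  simp only [Matrix.sub_apply, Matrix.smul_apply, Matrix.mul_apply, Matrix.of_apply, smul_eq_mul, Matrix.sum_apply, Matrix.submatrix_apply]

variable (Lc M') (lev : ℕ → ℕ) (rs : ℕ → (Fin (3 + 1) → ℕ))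

/-- [folklore] **`torus_d2_tower` — (COV-m) ORDER 2: THE TOP STEP's COARSE COVARIANCE ROW `d2` AT EVERY DEPTH, AS DISPLAYED IN #21 (`= 0`).**  With `Dbar := σ_{n+1} • D̄` (`c0`),
`Q₂₀` the door's `hQ₂₀` VERBATIM (level `lev 0`, root `rs 0`, presentation `(pμ′, mμ′)`), `D̄₁` (C2) and `D̄₂` (`torus_c2_tower`) the composite coarse jets, `Q₂₁` C2's `torus_d1_tower`
letter (the top step's rooted first-order members along the direction TRANSPORTED ONE LEVEL UP, weight `c·θ_{n+1}`, `θ_{n+1} = Lc^{d+1}·stepScale 3 Lc (lev 0) ∕ σ_{n+1}`), and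
**`Q₂₂ := c_{lev 0} • Σ_b Σ_{b′} ((cθ_{n+1}·(compRows·h)) b · (cθ_{n+1}·(compRows·h)) b′) •` the top step's ♭ BI-MEMBER `T^{b,b′}`** in the door's presentation (ONE summand — U23♭'s
shape; NO `Q₂₁`-member on an inner second jet): `Q₂₂·Dbar + 2•(Q₂₁·D̄₁) + Q₂₀·D̄₂ = 0` (§2's residual law: the tip terms cancel by `c_{lev 0}·σ·θ = 1`, the squared-weight terms
by `c_{lev 0}·θ = σ⁻¹`). -/
theorem torus_d2_towerSym (hc : ctrOff (3 + 1) Lc ∈ box (3 + 1) Lc) (hM' : ∀ i, Lc ∣ M' i) (n : ℕ) (c : ℝ)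
    (h : ↥(pbox (towerTorus Lc M' (n + 1))) × Fin (3 + 1) → ℝ) {κ : Type*} (pμ' : κ → ↥(pbox M')) (mμ' : κ → Fin (3 + 1)) :
    (((Lc : ℝ) ^ (3 + 1) * stepScale 3 Lc (lev 0))⁻¹ •
        ∑ b : ↥(pbox M') × Fin (3 + 1), ∑ b' : ↥(pbox M') × Fin (3 + 1),
          (((c * (((Lc : ℝ) ^ (3 + 1) * stepScale 3 Lc (lev 0)) * (∏ i ∈ range (n + 1), (stepScale 3 Lc (lev (i + 1)) * ((box (3 + 1) Lc).card : ℝ)))⁻¹))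
              * (compRowsSym Lc M' lev (fun _ : ℕ => ctrOff (3 + 1) Lc) (n + 1) *ᵥ h) b)
            * ((c * (((Lc : ℝ) ^ (3 + 1) * stepScale 3 Lc (lev 0)) * (∏ i ∈ range (n + 1), (stepScale 3 Lc (lev (i + 1)) * ((box (3 + 1) Lc).card : ℝ)))⁻¹))
              * (compRowsSym Lc M' lev (fun _ : ℕ => ctrOff (3 + 1) Lc) (n + 1) *ᵥ h) b')) •
          (perF M' (dper M' (fun x z a e => ∑' m : Site (3 + 1), (1 / 2 : ℝ) *
            (symVh₂SAt (ctr (3 + 1) Lc) Lc b.2 (b.1 : Site (3 + 1)) b'.2 (translate M' (b'.1 : Site (3 + 1)) m) x z a e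
              + symVh₂SAt (ctr (3 + 1) Lc) Lc b'.2 (translate M' (b'.1 : Site (3 + 1)) m) b.2 (b.1 : Site (3 + 1)) x z a e)))).submatrix
            (fun k : κ => ((pμ' k, Sum.inr (mμ' k)) : Idx M' (Fib 3))) (fun e : ↥(pbox M') × Fin (3 + 1) => ((e.1, Sum.inl e.2) : Idx M' (Fib 3))))
        * ((∏ i ∈ range (n + 1), (stepScale 3 Lc (lev (i + 1)) * ((box (3 + 1) Lc).card : ℝ))) •
            (tgrad M').submatrix (fun a : ↥(pbox M') × Fin (3 + 1) => ((a.1, Sum.inl a.2) : Idx M' (Fib 3))) (fun t : Res (toSite (ctrOff (3 + 1) Lc)) Lc M' => (t.1 : ↥(pbox M'))))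
      + (2 : ℝ) • ((∑ a' : ↥(pbox M') × Fin (3 + 1),
          ((c * (((Lc : ℝ) ^ (3 + 1) * stepScale 3 Lc (lev 0)) * (∏ i ∈ range (n + 1), (stepScale 3 Lc (lev (i + 1)) * ((box (3 + 1) Lc).card : ℝ)))⁻¹))
            * (compRowsSym Lc M' lev (fun _ : ℕ => ctrOff (3 + 1) Lc) (n + 1) *ᵥ h) a') •
          (perF M' (dper M' (symVhSAt (ctr (3 + 1) Lc) 3 Lc rfl a'.2 (a'.1 : Site (3 + 1))))).submatrix (fun k : κ => ((pμ' k, Sum.inr (mμ' k)) : Idx M' (Fib 3)))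
            (fun b : ↥(pbox M') × Fin (3 + 1) => ((b.1, Sum.inl b.2) : Idx M' (Fib 3))))
          * Matrix.of (fun (a : ↥(pbox M') × Fin (3 + 1)) (t : Res (toSite (ctrOff (3 + 1) Lc)) Lc M') =>
              -(c * (compRowsSym Lc M' lev (fun _ : ℕ => ctrOff (3 + 1) Lc) (n + 1) *ᵥ h) a * tdelta M' ((a.1 : Site (3 + 1)) + unitVec a.2) t.1)))
      + (perF M' (bhKStepSh 3 Lc (Dsh Lc) (lev 0))).submatrix (fun a : κ => ((pμ' a, Sum.inr (mμ' a)) : Idx M' (Fib 3)))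
          (fun b : ↥(pbox M') × Fin (3 + 1) => ((b.1, Sum.inl b.2) : Idx M' (Fib 3)))
        * Matrix.of (fun (a : ↥(pbox M') × Fin (3 + 1)) (t : Res (toSite (ctrOff (3 + 1) Lc)) Lc M') =>
            (c ^ 2 * (∏ i ∈ range (n + 1), (stepScale 3 Lc (lev (i + 1)) * ((box (3 + 1) Lc).card : ℝ)))⁻¹)
              * ((compRowsSym Lc M' lev (fun _ : ℕ => ctrOff (3 + 1) Lc) (n + 1) *ᵥ h) a) ^ 2 * tdelta M' ((a.1 : Site (3 + 1)) + unitVec a.2) t.1)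
      = 0 := by
  have hB : (box (3 + 1) Lc).Nonempty := ⟨ctrOff (3 + 1) Lc, hc⟩
  have hσ := prod_stepScale_mul_card_ne_zero' Lc hB (fun i => lev (i + 1)) (n + 1)
  have hL : (Lc : ℝ) ^ (3 + 1) * stepScale 3 Lc (lev 0) ≠ 0 := mul_ne_zero (pow_ne_zero _ (by exact_mod_cast NeZero.ne Lc)) (stepScale_ne_zero _)
  -- abbreviations for the three scalars: `c₀ = c_{lev 0}`, `σ = σ_{n+1}`, `κ = c·θ_{n+1}`
  set c₀ : ℝ := ((Lc : ℝ) ^ (3 + 1) * stepScale 3 Lc (lev 0))⁻¹ with hc₀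
  set σ : ℝ := (∏ i ∈ range (n + 1), (stepScale 3 Lc (lev (i + 1)) * ((box (3 + 1) Lc).card : ℝ))) with hσdef
  set kap : ℝ := c * (((Lc : ℝ) ^ (3 + 1) * stepScale 3 Lc (lev 0)) * σ⁻¹) with hkap
  set v : ↥(pbox M') × Fin (3 + 1) → ℝ := compRowsSym Lc M' lev (fun _ : ℕ => ctrOff (3 + 1) Lc) (n + 1) *ᵥ h with hv
  -- `c₀·σ·κ = c` via `c₀ · (Lc^{d+1}·stepScale) = 1`, and `σ·σ⁻¹ = 1`
  have hunit : c₀ * ((Lc : ℝ) ^ (3 + 1) * stepScale 3 Lc (lev 0)) = 1 := by rw [hc₀, inv_mul_cancel₀ hL]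
  have hσinv : σ * σ⁻¹ = 1 := mul_inv_cancel₀ hσ
  have hk : c₀ * σ * kap = c := by
    rw [hkap, show c₀ * σ * (c * (((Lc : ℝ) ^ (3 + 1) * stepScale 3 Lc (lev 0)) * σ⁻¹))
      = c * (c₀ * ((Lc : ℝ) ^ (3 + 1) * stepScale 3 Lc (lev 0))) * (σ * σ⁻¹) by ring, hunit, hσinv]; ring
  -- the weighted contact matrices as multiples of the unweighted ones
  have e1 : Matrix.of (fun (b : ↥(pbox M') × Fin (3 + 1)) (t : Res (toSite (ctrOff (3 + 1) Lc)) Lc M') => (kap * v b) * tdelta M' ((b.1 : Site (3 + 1)) + unitVec b.2) t.1)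
      = kap • Matrix.of (fun (b : ↥(pbox M') × Fin (3 + 1)) (t : Res (toSite (ctrOff (3 + 1) Lc)) Lc M') => v b * tdelta M' ((b.1 : Site (3 + 1)) + unitVec b.2) t.1) := by
    ext b t; simp only [Matrix.of_apply, Matrix.smul_apply, smul_eq_mul, mul_assoc]
  have e2 : Matrix.of (fun (b : ↥(pbox M') × Fin (3 + 1)) (t : Res (toSite (ctrOff (3 + 1) Lc)) Lc M') => ((kap * v b) * (kap * v b)) * tdelta M' ((b.1 : Site (3 + 1)) + unitVec b.2) t.1)
      = (kap * kap) • Matrix.of (fun (b : ↥(pbox M') × Fin (3 + 1)) (t : Res (toSite (ctrOff (3 + 1) Lc)) Lc M') => (v b * v b) * tdelta M' ((b.1 : Site (3 + 1)) + unitVec b.2) t.1) := by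
    ext b t; simp only [Matrix.of_apply, Matrix.smul_apply, smul_eq_mul]; ring
  have e3 : Matrix.of (fun (a : ↥(pbox M') × Fin (3 + 1)) (t : Res (toSite (ctrOff (3 + 1) Lc)) Lc M') => -(c * v a * tdelta M' ((a.1 : Site (3 + 1)) + unitVec a.2) t.1))
      = -(c • Matrix.of (fun (b : ↥(pbox M') × Fin (3 + 1)) (t : Res (toSite (ctrOff (3 + 1) Lc)) Lc M') => v b * tdelta M' ((b.1 : Site (3 + 1)) + unitVec b.2) t.1)) := by
    ext a t; simp only [Matrix.of_apply, Matrix.neg_apply, Matrix.smul_apply, smul_eq_mul, mul_assoc]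
  have e4 : Matrix.of (fun (a : ↥(pbox M') × Fin (3 + 1)) (t : Res (toSite (ctrOff (3 + 1) Lc)) Lc M') => (c ^ 2 * σ⁻¹) * (v a) ^ 2 * tdelta M' ((a.1 : Site (3 + 1)) + unitVec a.2) t.1)
      = (c ^ 2 * σ⁻¹) • Matrix.of (fun (b : ↥(pbox M') × Fin (3 + 1)) (t : Res (toSite (ctrOff (3 + 1) Lc)) Lc M') => (v b * v b) * tdelta M' ((b.1 : Site (3 + 1)) + unitVec b.2) t.1) := by
    ext a t; simp only [Matrix.of_apply, Matrix.smul_apply, smul_eq_mul, sq, mul_assoc]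
  -- the weighted first-order members as `κ •` the `v`-weighted ones
  have e5 : (∑ a' : ↥(pbox M') × Fin (3 + 1), (kap * v a') •
          (perF M' (dper M' (symVhSAt (ctr (3 + 1) Lc) 3 Lc rfl a'.2 (a'.1 : Site (3 + 1))))).submatrix (fun k : κ => ((pμ' k, Sum.inr (mμ' k)) : Idx M' (Fib 3)))
            (fun b : ↥(pbox M') × Fin (3 + 1) => ((b.1, Sum.inl b.2) : Idx M' (Fib 3))))
      = kap • ∑ a' : ↥(pbox M') × Fin (3 + 1), v a' •
          (perF M' (dper M' (symVhSAt (ctr (3 + 1) Lc) 3 Lc rfl a'.2 (a'.1 : Site (3 + 1))))).submatrix (fun k : κ => ((pμ' k, Sum.inr (mμ' k)) : Idx M' (Fib 3)))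
            (fun b : ↥(pbox M') × Fin (3 + 1) => ((b.1, Sum.inl b.2) : Idx M' (Fib 3))) := by
    rw [Finset.smul_sum]
    exact Finset.sum_congr rfl fun a' _ => by rw [smul_smul]
  rw [Matrix.mul_smul, Matrix.smul_mul, bimember_mul_tgrad_res_sym hc hM' (lev 0) pμ' mμ' (fun b => kap * v b), e1, e2, e3, e4, e5]
  simp only [Matrix.smul_mul, Matrix.mul_smul, Matrix.mul_neg, smul_sub, smul_neg, smul_smul]
  match_scalars <;> first
    | linear_combination ((2 : ℝ) * kap) * hk
    | linear_combination (-(c + c₀ * σ * kap) * σ⁻¹) * hk + (c₀ ^ 2 * kap ^ 2 * σ) * hσinv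

end RowD2

end Summit.QuantumFields.BalabanUV.Beta.FP.TorusCompositeCovarianceTwoRowsSym

end
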